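import Literature.MathematicalPhysics.PowerSystems.DroopMicrogridRegionOfAttraction

/-!
# The droop microgrid with `Q–V` dynamics: for every angle configuration the reactive power-flow /
# voltage-droop equations have EXACTLY ONE positive voltage solution — the voltage profile `V°(θ)`
# is the unique minimiser of the strictly convex, coercive function `V ↦ H(θ, 0, V)`

Topic `Literature/MathematicalPhysics/PowerSystems`, namespace
`Literature.MathematicalPhysics.PowerSystems`, sub-namespace `DroopPH`.  Companion of
`DroopMicrogridHamiltonian.lean` (model (9), Hamiltonian (10), `∂H/∂V` (11c)),
`DroopMicrogridEquilibriumConvergence.lean` (★ #249) and `DroopMicrogridRegionOfAttraction.lean`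
(★ #255; §5 there: a positive critical point of `V ↦ H(θ, 0, V)` is a global minimiser —
`H_zeroFreq_le_of_critical`).  0 named facts.

## The statement and its source

At fixed angles `θ` (and `ω̃ = 0`) the printed Hamiltonian (10) is, as a function of the voltage
magnitudes `V ∈ ℝⁿ_{>0}`,
`H(θ, 0, V) = Σ_i (V_i/k_Qi − Q^u_i ln V_i) − ½ Σ_iΣ_j B_ij V_iV_j cos θ_ij − Σ_i P^u_i θ_i`,
whose `V`-Hessian is the printed block `D(u) + T(x)` of (15) with `D(u) = diag(Q^u_i/V_i²) ≻ 0`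
(15b) and `T(x) ⪰ 0` for a dominantly inductive `B` (Shin–Zavala, proof of Prop. 2 in Appendix B:
«`D(u)` is PD … `T(x)` is a (weighted) Laplacian … PSD»).  Hence `V ↦ H(θ, 0, V)` is STRICTLY convex
on the open orthant; it is also coercive there (`−Q^u_i ln V_i → +∞` at `0⁺`, `V_i/k_Qi → +∞` at
`+∞`, the coupling form being `≥ 0`).  Its critical points are exactly the solutions of
`∂H/∂V_i = 1/k_Qi − (Q^u_i − Q_i(θ, V))/V_i = 0` (11c), i.e. of the steady-state voltage law
`V_i = k_Qi (Q^u_i − Q_i(θ, V))` of (9c) — the reactive power-flow equations of the droop-controlled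
network at the angles `θ` («the equilibrium voltage is given by V^s_i = V^d_i − k_Qi(Q^s_i − Q^d_i)»,
Schiffer et al. Remark 4.3).  CONSEQUENCE (this file): **for every `θ` there is exactly one
`V°(θ) ∈ ℝⁿ_{>0}` solving them**, and `H(θ, 0, V°(θ)) < H(θ, 0, V)` for every other `V > 0`.

## What is proved

* §1 scalar bounds for `φ(v) = v/k − q ln v` (`k, q > 0`): `φ ≥ q − q ln(qk)`, and explicit
  two-sided bounds `e^{−L/q} ≤ v ≤ 2k(L − q + q ln(2qk))` on `{φ ≤ L}`;
* §2 `H(θ, 0, V) ≥ Σ_i φ_i(V_i) − Σ_i P^u_iθ_i` (`cosForm_nonpos`) and the a-priori box: every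
  `V > 0` with `H(θ, 0, V) ≤ L` lies in an explicit compact box `[a, b] ⊂ ℝⁿ_{>0}`
  (`mem_box_of_H_le`);
* §3 **strict** minimality at a critical point (`H_zeroFreq_lt_of_critical`: `V ≠ V°` ⇒
  `H(θ,0,V°) < H(θ,0,V)`), hence **uniqueness** of positive critical points
  (`voltageSolution_unique`);
* §4 **existence** (`exists_voltageSolution`): minimise the continuous `H(θ, 0, ·)` over the compact
  box, show the minimiser is a global minimiser over the open orthant, and apply Fermat along the
  coordinate lines (`hasDerivAt_H_line` of the companion); **`existsUnique_voltageSolution`**; the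
  dictionary `dHV_eq_zero_iff_voltageLaw` (critical ⇔ `V_i + k_Qi(Q_i − Q^u_i) = 0` ⇔ the
  `V̇`-row of (9) vanishes) and `mem_equilibria_iff` (the equilibria of (9) are exactly the states
  `(θ, 0, V°(θ))` with `P(θ, V°(θ)) = P^u`: the voltages of an equilibrium are DETERMINED by its
  angles); the frontier hypothesis of the well theorems from the profile
  (`frontier_lt_iff_voltageProfile`).

THREE COLUMNS.  Mathematics about MODEL `DroopPH` (lossless, `B` symmetric dominantly inductive,
`k_Q > 0`, `Q^u > 0`); no numerics; nothing says a converter, microgrid or grid is stable.  A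
certificate that needs `V°(θ)` at finitely many `θ` encloses it by interval Newton; this file
guarantees the object exists and is unique, so any enclosure of A solution encloses THE solution.
-/

noncomputable section

open Real Set Filter Topology Metric Finset

namespace Literature.MathematicalPhysics.PowerSystems

namespace DroopPH

variable {n : ℕ} (M : DroopPH n)

/-! ## §1 The scalar potential `φ(v) = v/k − q ln v` -/

omit M in
/-- `v/k − q ln v ≥ q − q ln(qk)` for `k, q, v > 0` (tangent bound of the concave logarithm at the
minimiser `v = qk`). [folklore] -/
private theorem phi_ge {k q v : ℝ} (hk : 0 < k) (hq : 0 < q) (hv : 0 < v) :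
    q - q * Real.log (q * k) ≤ v / k - q * Real.log v := by
  have hqk : 0 < q * k := mul_pos hq hk
  have h := Real.log_le_sub_one_of_pos (div_pos hv hqk)
  rw [Real.log_div hv.ne' hqk.ne'] at h
  have e : v / (q * k) - 1 = (v / k - q) / q := by field_simp
  rw [e, le_div_iff₀ hq] at h
  nlinarith [h]

omit M in
/-- Lower bound on a sublevel: `v/k − q ln v ≤ L` ⇒ `e^{−L/q} ≤ v`. [folklore] -/
private theorem exp_le_of_phi_le {k q v L : ℝ} (hk : 0 < k) (hq : 0 < q) (hv : 0 < v)
    (hL : v / k - q * Real.log v ≤ L) : Real.exp (-L / q) ≤ v := by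
  have h1 : 0 ≤ v / k := div_nonneg hv.le hk.le
  have h2 : -L / q ≤ Real.log v := by
    rw [div_le_iff₀ hq]
    nlinarith
  calc Real.exp (-L / q) ≤ Real.exp (Real.log v) := Real.exp_le_exp.2 h2
    _ = v := Real.exp_log hv

omit M in
/-- Upper bound on a sublevel: `v/k − q ln v ≤ L` ⇒ `v ≤ 2k(L − q + q ln(2qk))`. [folklore] -/
private theorem le_of_phi_le {k q v L : ℝ} (hk : 0 < k) (hq : 0 < q) (hv : 0 < v)
    (hL : v / k - q * Real.log v ≤ L) : v ≤ 2 * k * (L - q + q * Real.log (2 * q * k)) := by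
  have h := phi_ge (k := 2 * k) (q := q) (by linarith) hq hv
  have e1 : v / (2 * k) = v / k / 2 := by rw [div_div, mul_comm]
  have e2 : q * (2 * k) = 2 * q * k := by ring
  rw [e1, e2] at h
  have h2 : v / k ≤ 2 * (L - q + q * Real.log (2 * q * k)) := by linarith
  have h3 : v = k * (v / k) := by field_simp
  rw [h3]
  nlinarith [h2, hk]

/-! ## §2 `H(θ, 0, V)` dominates the decoupled potential; the a-priori box of a sublevel set -/

/-- The decoupled lower bound: `H(θ, 0, V) ≥ Σ_i (V_i/k_Qi − Q^u_i ln V_i) − Σ_i P^u_i θ_i` for a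
dominantly inductive symmetric `B` (the coupling part `−½Σ_iΣ_j B_ij V_iV_j cos θ_ij` is `≥ 0`).
[cite: ShinZavala2020, eq. (10) and Appendix B (T(x) ⪰ 0); SchifferEtAl2014, Assumption 4.1] -/
theorem H_zeroFreq_ge_decoupled (hB : ∀ i j, M.B i j = M.B j i)
    (hBoff : ∀ i j, i ≠ j → 0 ≤ M.B i j) (hBrow : ∀ i, ∑ j, M.B i j ≤ 0) (θ V : Fin n → ℝ) :
    ∑ i, (V i / M.kQ i - M.Qu i * Real.log (V i)) - ∑ i, M.Pu i * θ i
      ≤ M.H ((θ, 0, V) : State n) := by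
  have hform := M.cosForm_nonpos hB hBoff hBrow θ V
  have hC : ∑ i, ∑ j, M.B i j * V i * V j * cos (θ i - θ j)
      = ∑ i, ∑ j, M.B i j * cos (θ i - θ j) * V i * V j :=
    Finset.sum_congr rfl fun i _ => Finset.sum_congr rfl fun j _ => by ring
  have h0 : ∀ i, M.τP i / (2 * M.kP i) * (0 : ℝ) ^ 2 + V i / M.kQ i - M.Qu i * Real.log (V i)
      - M.Pu i * θ i = (V i / M.kQ i - M.Qu i * Real.log (V i)) - M.Pu i * θ i := fun i => by ring
  simp only [H, Pi.zero_apply, h0, Finset.sum_sub_distrib]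
  rw [hC]
  linarith

/-- The sum of the scalar minima `m = Σ_i (Q^u_i − Q^u_i ln(Q^u_i k_Qi))`. [folklore] -/
def phiMinSum : ℝ := ∑ i, (M.Qu i - M.Qu i * Real.log (M.Qu i * M.kQ i))

/-- The level available to coordinate `i` on the sublevel `{H(θ,0,·) ≤ L}`:
`L_i = L + Σ_j P^u_jθ_j − m + m_i`. [folklore] -/
def coordLevel (θ : Fin n → ℝ) (L : ℝ) (i : Fin n) : ℝ :=
  L + ∑ j, M.Pu j * θ j - M.phiMinSum + (M.Qu i - M.Qu i * Real.log (M.Qu i * M.kQ i))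

/-- **A-priori box**: every `V > 0` with `H(θ, 0, V) ≤ L` satisfies, coordinatewise,
`e^{−L_i/Q^u_i} ≤ V_i ≤ 2k_Qi(L_i − Q^u_i + Q^u_i ln(2Q^u_ik_Qi))` (`k_Q, Q^u > 0`, dominantly
inductive symmetric `B`) — coercivity of `V ↦ H(θ, 0, V)` on the open orthant, quantified.
[cite: ShinZavala2020, eq. (10), (15b) and Appendix B] -/
theorem mem_box_of_H_le (hB : ∀ i j, M.B i j = M.B j i) (hBoff : ∀ i j, i ≠ j → 0 ≤ M.B i j)
    (hBrow : ∀ i, ∑ j, M.B i j ≤ 0) (hkQ : ∀ i, 0 < M.kQ i) (hQu : ∀ i, 0 < M.Qu i)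
    (θ : Fin n → ℝ) {V : Fin n → ℝ} (hV : ∀ i, 0 < V i) {L : ℝ}
    (hL : M.H ((θ, 0, V) : State n) ≤ L) (i : Fin n) :
    Real.exp (-M.coordLevel θ L i / M.Qu i) ≤ V i ∧
      V i ≤ 2 * M.kQ i * (M.coordLevel θ L i - M.Qu i + M.Qu i * Real.log (2 * M.Qu i * M.kQ i)) := by
  have hdec := M.H_zeroFreq_ge_decoupled hB hBoff hBrow θ V
  -- the other coordinates are bounded below by their minima
  have hrest : ∑ j, (V j / M.kQ j - M.Qu j * Real.log (V j))
      ≥ (V i / M.kQ i - M.Qu i * Real.log (V i))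
        + (M.phiMinSum - (M.Qu i - M.Qu i * Real.log (M.Qu i * M.kQ i))) := by
    have h1 : ∑ j, (V j / M.kQ j - M.Qu j * Real.log (V j))
        = (V i / M.kQ i - M.Qu i * Real.log (V i))
          + ∑ j ∈ Finset.univ.erase i, (V j / M.kQ j - M.Qu j * Real.log (V j)) := by
      rw [← Finset.add_sum_erase _ _ (Finset.mem_univ i)]
    have h2 : M.phiMinSum = (M.Qu i - M.Qu i * Real.log (M.Qu i * M.kQ i))
          + ∑ j ∈ Finset.univ.erase i, (M.Qu j - M.Qu j * Real.log (M.Qu j * M.kQ j)) := by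
      rw [phiMinSum, ← Finset.add_sum_erase _ _ (Finset.mem_univ i)]
    have h3 : ∑ j ∈ Finset.univ.erase i, (M.Qu j - M.Qu j * Real.log (M.Qu j * M.kQ j))
        ≤ ∑ j ∈ Finset.univ.erase i, (V j / M.kQ j - M.Qu j * Real.log (V j)) :=
      Finset.sum_le_sum fun j _ => phi_ge (hkQ j) (hQu j) (hV j)
    rw [h1, h2]; linarith
  have hphi : V i / M.kQ i - M.Qu i * Real.log (V i) ≤ M.coordLevel θ L i := by
    rw [coordLevel]; linarith
  exact ⟨exp_le_of_phi_le (hkQ i) (hQu i) (hV i) hphi, le_of_phi_le (hkQ i) (hQu i) (hV i) hphi⟩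

/-! ## §3 Strict minimality at a critical point and uniqueness of the voltage solution -/

/-- **Strict global minimality of a critical voltage vector.**  If `∂H/∂V(θ, 0, V°) = 0` with
`V° > 0`, then `H(θ, 0, V°) < H(θ, 0, V)` for every `V > 0`, `V ≠ V°` (strict concavity of `ln` in
the coordinate where `V` differs, plus `cosForm_nonpos`). [cite: ShinZavala2020, eq. (15b) and Appendix B (D(u) + T(x) ≻ 0)] -/
theorem H_zeroFreq_lt_of_critical (hB : ∀ i j, M.B i j = M.B j i)
    (hBoff : ∀ i j, i ≠ j → 0 ≤ M.B i j) (hBrow : ∀ i, ∑ j, M.B i j ≤ 0) (hQu : ∀ i, 0 < M.Qu i)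
    (θ : Fin n → ℝ) {Vc V : Fin n → ℝ} (hVc : ∀ i, 0 < Vc i) (hV : ∀ i, 0 < V i)
    (hcrit : ∀ i, M.dHV (θ, 0, Vc) i = 0) (hne : V ≠ Vc) :
    M.H ((θ, 0, Vc) : State n) < M.H ((θ, 0, V) : State n) := by
  obtain ⟨i₀, hi₀⟩ : ∃ i, V i ≠ Vc i := by
    by_contra h
    push Not at h
    exact hne (funext h)
  set C : (Fin n → ℝ) → ℝ := fun U => ∑ i, ∑ j, M.B i j * U i * U j * cos (θ i - θ j) with hC
  have hH : ∀ U : Fin n → ℝ, M.H ((θ, 0, U) : State n)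
      = ∑ i, (M.τP i / (2 * M.kP i) * (0 : ℝ) ^ 2 + U i / M.kQ i - M.Qu i * Real.log (U i)
          - M.Pu i * θ i) - 1 / 2 * C U := fun U => by
    simp only [H, hC, Pi.zero_apply]
  have eH : M.H ((θ, 0, V) : State n) - M.H ((θ, 0, Vc) : State n)
      = ∑ i, ((V i - Vc i) / M.kQ i - M.Qu i * (Real.log (V i) - Real.log (Vc i)))
        - 1 / 2 * (C V - C Vc) := by
    have ht : ∑ i, (M.τP i / (2 * M.kP i) * (0 : ℝ) ^ 2 + V i / M.kQ i - M.Qu i * Real.log (V i)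
        - M.Pu i * θ i) - ∑ i, (M.τP i / (2 * M.kP i) * (0 : ℝ) ^ 2 + Vc i / M.kQ i
        - M.Qu i * Real.log (Vc i) - M.Pu i * θ i)
        = ∑ i, ((V i - Vc i) / M.kQ i - M.Qu i * (Real.log (V i) - Real.log (Vc i))) := by
      rw [← Finset.sum_sub_distrib]
      exact Finset.sum_congr rfl fun i _ => by ring
    rw [hH V, hH Vc, ← ht]
    ring
  have hcrit' : ∀ i, (V i - Vc i) / M.kQ i
      = M.Qu i * ((V i - Vc i) / Vc i) + (V i - Vc i) * ∑ j, M.B i j * cos (θ i - θ j) * Vc j := by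
    intro i
    have h := hcrit i
    simp only [dHV, Q] at h
    have hne' : Vc i ≠ 0 := (hVc i).ne'
    have h' : 1 / M.kQ i = M.Qu i / Vc i + ∑ j, M.B i j * cos (θ i - θ j) * Vc j := by
      have h2 : (M.Qu i - -∑ j, Vc i * Vc j * M.B i j * cos (θ i - θ j)) / Vc i
          = M.Qu i / Vc i + ∑ j, M.B i j * cos (θ i - θ j) * Vc j := by
        rw [sub_neg_eq_add, add_div, Finset.sum_div]
        congr 1
        exact Finset.sum_congr rfl fun j _ => by rw [div_eq_iff hne']; ring
      linarith [h2]
    have h3 : (V i - Vc i) * (1 / M.kQ i)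
        = (V i - Vc i) * (M.Qu i / Vc i + ∑ j, M.B i j * cos (θ i - θ j) * Vc j) := by rw [h']
    rw [div_eq_mul_one_div, h3]
    ring
  -- concavity of the logarithm, strict at `i₀`
  have hlog : ∀ i, M.Qu i * (Real.log (V i) - Real.log (Vc i)) ≤ M.Qu i * ((V i - Vc i) / Vc i) := by
    intro i
    refine mul_le_mul_of_nonneg_left ?_ (hQu i).le
    have h := Real.log_le_sub_one_of_pos (div_pos (hV i) (hVc i))
    rw [Real.log_div (hV i).ne' (hVc i).ne'] at h
    have e : (V i - Vc i) / Vc i = V i / Vc i - 1 := by rw [sub_div, div_self (hVc i).ne']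
    linarith [e]
  have hlog₀ : M.Qu i₀ * (Real.log (V i₀) - Real.log (Vc i₀))
      < M.Qu i₀ * ((V i₀ - Vc i₀) / Vc i₀) := by
    refine mul_lt_mul_of_pos_left ?_ (hQu i₀)
    have hne1 : V i₀ / Vc i₀ ≠ 1 := by
      intro h; exact hi₀ (by rwa [div_eq_one_iff_eq (hVc i₀).ne'] at h)
    have h := Real.log_lt_sub_one_of_pos (div_pos (hV i₀) (hVc i₀)) hne1
    rw [Real.log_div (hV i₀).ne' (hVc i₀).ne'] at h
    have e : (V i₀ - Vc i₀) / Vc i₀ = V i₀ / Vc i₀ - 1 := by rw [sub_div, div_self (hVc i₀).ne']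
    linarith [e]
  set d : Fin n → ℝ := fun i => V i - Vc i with hd
  have hCexp : C V - C Vc = ∑ i, ∑ j, M.B i j * cos (θ i - θ j) * d i * d j
      + 2 * ∑ i, ∑ j, M.B i j * cos (θ i - θ j) * d i * Vc j := by
    have hsw : ∑ i, ∑ j, M.B i j * cos (θ i - θ j) * Vc i * d j
        = ∑ i, ∑ j, M.B i j * cos (θ i - θ j) * d i * Vc j := by
      rw [Finset.sum_comm]
      refine Finset.sum_congr rfl fun i _ => Finset.sum_congr rfl fun j _ => ?_
      rw [hB j i, show cos (θ j - θ i) = cos (θ i - θ j) by rw [← Real.cos_neg, neg_sub]]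
      ring
    have e1 : C V - C Vc = ∑ i, ∑ j, M.B i j * cos (θ i - θ j) * d i * d j
        + ∑ i, ∑ j, M.B i j * cos (θ i - θ j) * d i * Vc j
        + ∑ i, ∑ j, M.B i j * cos (θ i - θ j) * Vc i * d j := by
      simp only [hC, ← Finset.sum_add_distrib, ← Finset.sum_sub_distrib]
      refine Finset.sum_congr rfl fun i _ => Finset.sum_congr rfl fun j _ => ?_
      simp only [hd]; ring
    rw [e1, hsw]; ring
  have hform := M.cosForm_nonpos hB hBoff hBrow θ d
  have hlin : ∑ i, (V i - Vc i) * ∑ j, M.B i j * cos (θ i - θ j) * Vc j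
      < ∑ i, ((V i - Vc i) / M.kQ i - M.Qu i * (Real.log (V i) - Real.log (Vc i))) := by
    refine Finset.sum_lt_sum (fun i _ => ?_) ⟨i₀, Finset.mem_univ _, ?_⟩
    · rw [hcrit' i]; linarith [hlog i]
    · rw [hcrit' i₀]; linarith [hlog₀]
  have hmix : ∑ i, (V i - Vc i) * ∑ j, M.B i j * cos (θ i - θ j) * Vc j
      = ∑ i, ∑ j, M.B i j * cos (θ i - θ j) * d i * Vc j := by
    refine Finset.sum_congr rfl fun i _ => ?_
    rw [Finset.mul_sum]
    exact Finset.sum_congr rfl fun j _ => by simp only [hd]; ring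
  have key : 0 < M.H ((θ, 0, V) : State n) - M.H ((θ, 0, Vc) : State n) := by
    rw [eH, hCexp]
    rw [hmix] at hlin
    nlinarith [hlin, hform]
  linarith

/-- **Uniqueness of the positive voltage solution at given angles**: two positive critical points of
`V ↦ H(θ, 0, V)` coincide. [cite: ShinZavala2020, eq. (15b) and Appendix B (strict convexity in V)] -/
theorem voltageSolution_unique (hB : ∀ i j, M.B i j = M.B j i)
    (hBoff : ∀ i j, i ≠ j → 0 ≤ M.B i j) (hBrow : ∀ i, ∑ j, M.B i j ≤ 0) (hQu : ∀ i, 0 < M.Qu i)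
    (θ : Fin n → ℝ) {V₁ V₂ : Fin n → ℝ} (h₁ : ∀ i, 0 < V₁ i) (h₂ : ∀ i, 0 < V₂ i)
    (hc₁ : ∀ i, M.dHV (θ, 0, V₁) i = 0) (hc₂ : ∀ i, M.dHV (θ, 0, V₂) i = 0) : V₁ = V₂ := by
  by_contra hne
  have h12 := M.H_zeroFreq_lt_of_critical hB hBoff hBrow hQu θ h₁ h₂ hc₁ (Ne.symm hne)
  have h21 := M.H_zeroFreq_lt_of_critical hB hBoff hBrow hQu θ h₂ h₁ hc₂ hne
  linarith

/-! ## §4 Existence of the voltage solution; the voltage profile; equilibria -/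

/-- `V ↦ H(θ, 0, V)` is continuous on the open orthant. [cite: ShinZavala2020, §III-B («H(·,u) is twice continuously differentiable»)] -/
theorem continuousOn_H_zeroFreq (θ : Fin n → ℝ) :
    ContinuousOn (fun V : Fin n → ℝ => M.H ((θ, 0, V) : State n)) {V | ∀ i, 0 < V i} := by
  intro V hV
  have h1 : ContinuousAt M.H ((θ, 0, V) : State n) := M.continuousAt_H _ fun i => (hV i).ne'
  have h2 : Continuous fun U : Fin n → ℝ => ((θ, 0, U) : State n) :=
    continuous_const.prodMk (continuous_const.prodMk continuous_id)
  exact (ContinuousAt.comp (g := M.H) (f := fun U : Fin n → ℝ => ((θ, 0, U) : State n)) (x := V)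
    h1 h2.continuousAt).continuousWithinAt

/-- The coordinate derivative of `V ↦ H(θ, 0, V)` at a positive point is `∂H/∂V_i` (11c).
[cite: ShinZavala2020, eq. (11c)] -/
theorem hasDerivAt_H_coord (hB : ∀ i j, M.B i j = M.B j i) (θ : Fin n → ℝ) {V : Fin n → ℝ}
    (hV : ∀ i, 0 < V i) (i : Fin n) :
    HasDerivAt (fun e : ℝ => M.H ((θ, 0, V + e • Pi.single i 1) : State n))
      (M.dHV (θ, 0, V) i) 0 := by
  set x : State n := (θ, 0, V) with hx
  set v : State n := (0, 0, Pi.single i 1) with hv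
  have hpos : ∀ j, 0 < (x + (0 : ℝ) • v).2.2 j := fun j => by simpa [hx] using hV j
  have h := M.hasDerivAt_H_line hB x v hpos
  rw [zero_smul, add_zero] at h
  have hpair : pair (M.gradH x) v = M.dHV (θ, 0, V) i := by
    rw [pair_eq_sum]
    simp only [hv, gradH, Pi.zero_apply, mul_zero, zero_add, hx]
    rw [Finset.sum_eq_single i (fun j _ hj => by simp [Pi.single_eq_of_ne hj]) (by simp)]
    simp
  have hfun : (fun e : ℝ => M.H (x + e • v)) = fun e => M.H ((θ, 0, V + e • Pi.single i 1) : State n) := by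
    funext e
    simp only [hx, hv, Prod.smul_mk, smul_zero, Prod.mk_add_mk, add_zero]
  rw [hfun, hpair] at h
  exact h

/-- **Existence of the voltage solution**: for every angle vector `θ` there is `V° ∈ ℝⁿ_{>0}` with
`∂H/∂V(θ, 0, V°) = 0` (`k_Q > 0`, `Q^u > 0`, `B` symmetric dominantly inductive): minimise the
continuous coercive `H(θ, 0, ·)` over the a-priori box, and apply Fermat along coordinate lines.
[cite: ShinZavala2020, eqs. (10), (11c), (15b) and Appendix B; SchifferEtAl2014, Remark 4.3] -/
theorem exists_voltageSolution (hB : ∀ i j, M.B i j = M.B j i)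
    (hBoff : ∀ i j, i ≠ j → 0 ≤ M.B i j) (hBrow : ∀ i, ∑ j, M.B i j ≤ 0)
    (hkQ : ∀ i, 0 < M.kQ i) (hQu : ∀ i, 0 < M.Qu i) (θ : Fin n → ℝ) :
    ∃ V : Fin n → ℝ, (∀ i, 0 < V i) ∧ ∀ i, M.dHV (θ, 0, V) i = 0 := by
  -- reference point and level
  set V₁ : Fin n → ℝ := fun _ => 1 with hV₁
  have hV₁pos : ∀ i, 0 < V₁ i := fun _ => one_pos
  set L : ℝ := M.H ((θ, 0, V₁) : State n) with hL
  -- the a-priori box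
  set a : Fin n → ℝ := fun i => Real.exp (-M.coordLevel θ L i / M.Qu i) with ha
  set b : Fin n → ℝ := fun i =>
    2 * M.kQ i * (M.coordLevel θ L i - M.Qu i + M.Qu i * Real.log (2 * M.Qu i * M.kQ i)) with hb
  have hapos : ∀ i, 0 < a i := fun i => Real.exp_pos _
  have hbox : ∀ V : Fin n → ℝ, (∀ i, 0 < V i) → M.H ((θ, 0, V) : State n) ≤ L → V ∈ Icc a b :=
    fun V hV hVL => ⟨fun i => (M.mem_box_of_H_le hB hBoff hBrow hkQ hQu θ hV hVL i).1,
      fun i => (M.mem_box_of_H_le hB hBoff hBrow hkQ hQu θ hV hVL i).2⟩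
  have hK : IsCompact (Icc a b) := isCompact_Icc
  have hKpos : ∀ V ∈ Icc a b, ∀ i, 0 < V i := fun V hV i => lt_of_lt_of_le (hapos i) (hV.1 i)
  have hV₁K : V₁ ∈ Icc a b := hbox V₁ hV₁pos le_rfl
  have hcont : ContinuousOn (fun V : Fin n → ℝ => M.H ((θ, 0, V) : State n)) (Icc a b) :=
    (M.continuousOn_H_zeroFreq θ).mono fun V hV => hKpos V hV
  obtain ⟨Vc, hVcK, hmin⟩ := hK.exists_isMinOn ⟨V₁, hV₁K⟩ hcont
  have hVcpos : ∀ i, 0 < Vc i := hKpos Vc hVcK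
  -- `V°` minimises over the whole open orthant
  have hglob : ∀ V : Fin n → ℝ, (∀ i, 0 < V i) →
      M.H ((θ, 0, Vc) : State n) ≤ M.H ((θ, 0, V) : State n) := by
    intro V hV
    by_cases hVL : M.H ((θ, 0, V) : State n) ≤ L
    · exact hmin (hbox V hV hVL)
    · push Not at hVL
      exact ((hmin hV₁K).trans_lt hVL).le
  refine ⟨Vc, hVcpos, fun i => ?_⟩
  -- Fermat along the coordinate line through `V°`
  have hder := M.hasDerivAt_H_coord hB θ hVcpos i
  have hlocmin : IsLocalMin (fun e : ℝ => M.H ((θ, 0, Vc + e • Pi.single i 1) : State n)) 0 := by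
    have hev : ∀ᶠ e in 𝓝 (0 : ℝ), ∀ j, 0 < (Vc + e • (Pi.single i (1 : ℝ) : Fin n → ℝ)) j := by
      have h1 : ∀ᶠ e in 𝓝 (0 : ℝ), |e| < Vc i := by
        have : Iio (Vc i) ∈ 𝓝 (|(0 : ℝ)|) := by
          rw [abs_zero]; exact Iio_mem_nhds (hVcpos i)
        exact continuous_abs.continuousAt.preimage_mem_nhds this
      filter_upwards [h1] with e he j
      by_cases hj : j = i
      · subst hj
        simp only [Pi.add_apply, Pi.smul_apply, Pi.single_eq_same, smul_eq_mul, mul_one]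
        linarith [(abs_lt.1 he).1]
      · simp only [Pi.add_apply, Pi.smul_apply, Pi.single_eq_of_ne hj, smul_eq_mul, mul_zero,
          add_zero]
        exact hVcpos j
    filter_upwards [hev] with e he
    have h := hglob _ he
    simp only [zero_smul, add_zero]
    exact h
  exact hlocmin.hasDerivAt_eq_zero hder

/-- **For every angle configuration the voltage equations have exactly one positive solution.**
[cite: ShinZavala2020, eqs. (11c), (15b) and Appendix B; SchifferEtAl2014, Remark 4.3] -/
theorem existsUnique_voltageSolution (hB : ∀ i j, M.B i j = M.B j i)
    (hBoff : ∀ i j, i ≠ j → 0 ≤ M.B i j) (hBrow : ∀ i, ∑ j, M.B i j ≤ 0)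
    (hkQ : ∀ i, 0 < M.kQ i) (hQu : ∀ i, 0 < M.Qu i) (θ : Fin n → ℝ) :
    ∃! V : Fin n → ℝ, (∀ i, 0 < V i) ∧ ∀ i, M.dHV (θ, 0, V) i = 0 := by
  obtain ⟨V, hV, hc⟩ := M.exists_voltageSolution hB hBoff hBrow hkQ hQu θ
  exact ⟨V, ⟨hV, hc⟩, fun W hW => M.voltageSolution_unique hB hBoff hBrow hQu θ hW.1 hV hW.2 hc⟩

/-- **Dictionary**: at a state with `V_i ≠ 0`, `k_Qi ≠ 0`, the criticality `∂H/∂V_i = 0` (11c) is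
the steady-state voltage law `V_i + k_Qi(Q_i − Q^u_i) = 0` of (9c) — «the equilibrium voltage is
given by V^s_i = V^d_i − k_Qi(Q^s_i − Q^d_i)». [cite: ShinZavala2020, eqs. (9c), (11c); SchifferEtAl2014, Remark 4.3] -/
theorem dHV_eq_zero_iff_voltageLaw (x : State n) {i : Fin n} (hV : x.2.2 i ≠ 0)
    (hkQ : M.kQ i ≠ 0) :
    M.dHV x i = 0 ↔ x.2.2 i + M.kQ i * (M.Q x.1 x.2.2 i - M.Qu i) = 0 := by
  have e : M.dHV x i = (x.2.2 i + M.kQ i * (M.Q x.1 x.2.2 i - M.Qu i)) / (M.kQ i * x.2.2 i) := by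
    rw [dHV]
    field_simp
    ring
  rw [e, div_eq_zero_iff, or_iff_left (mul_ne_zero hkQ hV)]

/-- **The voltage profile** `V°(θ)`: the unique positive solution of the voltage equations at the
angles `θ`. [cite: ShinZavala2020, eqs. (11c), (15b), Appendix B] -/
def voltageProfile (hB : ∀ i j, M.B i j = M.B j i) (hBoff : ∀ i j, i ≠ j → 0 ≤ M.B i j)
    (hBrow : ∀ i, ∑ j, M.B i j ≤ 0) (hkQ : ∀ i, 0 < M.kQ i) (hQu : ∀ i, 0 < M.Qu i)
    (θ : Fin n → ℝ) : Fin n → ℝ :=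
  Classical.choose (M.exists_voltageSolution hB hBoff hBrow hkQ hQu θ)

/-- The profile is positive and critical. [cite: ShinZavala2020, eqs. (11c), (15b), Appendix B] -/
theorem voltageProfile_spec (hB : ∀ i j, M.B i j = M.B j i) (hBoff : ∀ i j, i ≠ j → 0 ≤ M.B i j)
    (hBrow : ∀ i, ∑ j, M.B i j ≤ 0) (hkQ : ∀ i, 0 < M.kQ i) (hQu : ∀ i, 0 < M.Qu i)
    (θ : Fin n → ℝ) :
    (∀ i, 0 < M.voltageProfile hB hBoff hBrow hkQ hQu θ i) ∧
      ∀ i, M.dHV (θ, 0, M.voltageProfile hB hBoff hBrow hkQ hQu θ) i = 0 :=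
  Classical.choose_spec (M.exists_voltageSolution hB hBoff hBrow hkQ hQu θ)

/-- Every positive critical point IS the profile. [cite: ShinZavala2020, Appendix B] -/
theorem eq_voltageProfile_of_critical (hB : ∀ i j, M.B i j = M.B j i)
    (hBoff : ∀ i j, i ≠ j → 0 ≤ M.B i j) (hBrow : ∀ i, ∑ j, M.B i j ≤ 0)
    (hkQ : ∀ i, 0 < M.kQ i) (hQu : ∀ i, 0 < M.Qu i) (θ : Fin n → ℝ) {V : Fin n → ℝ}
    (hV : ∀ i, 0 < V i) (hc : ∀ i, M.dHV (θ, 0, V) i = 0) :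
    V = M.voltageProfile hB hBoff hBrow hkQ hQu θ :=
  M.voltageSolution_unique hB hBoff hBrow hQu θ hV (M.voltageProfile_spec hB hBoff hBrow hkQ hQu θ).1
    hc (M.voltageProfile_spec hB hBoff hBrow hkQ hQu θ).2

/-- **The profile minimises `H(θ, 0, ·)` over the open orthant.** [cite: ShinZavala2020, Appendix B] -/
theorem H_voltageProfile_le (hB : ∀ i j, M.B i j = M.B j i) (hBoff : ∀ i j, i ≠ j → 0 ≤ M.B i j)
    (hBrow : ∀ i, ∑ j, M.B i j ≤ 0) (hkQ : ∀ i, 0 < M.kQ i) (hQu : ∀ i, 0 < M.Qu i)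
    (θ : Fin n → ℝ) {V : Fin n → ℝ} (hV : ∀ i, 0 < V i) :
    M.H ((θ, 0, M.voltageProfile hB hBoff hBrow hkQ hQu θ) : State n) ≤ M.H ((θ, 0, V) : State n) :=
  M.H_zeroFreq_le_of_critical hB hBoff hBrow hQu θ (M.voltageProfile_spec hB hBoff hBrow hkQ hQu θ).1
    hV (M.voltageProfile_spec hB hBoff hBrow hkQ hQu θ).2

/-- **The equilibria of (9) are parametrised by their angles**: `x = (θ, ω̃, V)` with `V > 0` is an
equilibrium iff `ω̃ = 0`, `V = V°(θ)` and `P(θ, V°(θ)) = P^u` (`k, τ ≠ 0`).  So the equilibrium set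
`E` is the graph of the profile over the angle solutions of the ACTIVE power-flow equations.
[cite: ShinZavala2020, §II-D («the steady-state conditions f(x,u) = 0»), eqs. (9), (11c); SchifferEtAl2014, Remark 4.3] -/
theorem mem_equilibria_iff (hB : ∀ i j, M.B i j = M.B j i) (hBoff : ∀ i j, i ≠ j → 0 ≤ M.B i j)
    (hBrow : ∀ i, ∑ j, M.B i j ≤ 0) (hkP : ∀ i, 0 < M.kP i) (hτP : ∀ i, 0 < M.τP i)
    (hkQ : ∀ i, 0 < M.kQ i) (hτQ : ∀ i, 0 < M.τQ i) (hQu : ∀ i, 0 < M.Qu i) (x : State n) :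
    x ∈ M.equilibria ↔ x.2.1 = 0 ∧ x.2.2 = M.voltageProfile hB hBoff hBrow hkQ hQu x.1 ∧
      ∀ i, M.P x.1 x.2.2 i = M.Pu i := by
  have hsteady := M.field_eq_zero_iff_steady x (fun i => (hkP i).ne') (fun i => (hτP i).ne')
    (fun i => (hτQ i).ne')
  constructor
  · rintro ⟨hf, hV⟩
    obtain ⟨hω, hP, hVlaw⟩ := hsteady.1 hf
    have hcrit : ∀ i, M.dHV (x.1, 0, x.2.2) i = 0 := fun i =>
      (M.dHV_eq_zero_iff_voltageLaw (x.1, (0 : Fin n → ℝ), x.2.2) (hV i).ne' (hkQ i).ne').2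
        (hVlaw i)
    exact ⟨funext hω, M.eq_voltageProfile_of_critical hB hBoff hBrow hkQ hQu x.1 hV hcrit, hP⟩
  · rintro ⟨hω, hVeq, hP⟩
    have hspec := M.voltageProfile_spec hB hBoff hBrow hkQ hQu x.1
    have hV : ∀ i, 0 < x.2.2 i := fun i => by rw [hVeq]; exact hspec.1 i
    refine ⟨hsteady.2 ⟨fun i => congrFun hω i, hP, fun i => ?_⟩, hV⟩
    have hc : M.dHV (x.1, 0, x.2.2) i = 0 := by rw [hVeq]; exact hspec.2 i
    exact (M.dHV_eq_zero_iff_voltageLaw (x.1, (0 : Fin n → ℝ), x.2.2) (hV i).ne' (hkQ i).ne').1 hc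

/-- **The frontier hypothesis of the well theorems, decided by the profile**: `c < H(θ, 0, V)` for
all `V > 0` iff `c < H(θ, 0, V°(θ))`. [cite: SchifferEtAl2014, proof of Prop. 5.9; ShinZavala2020, Appendix B] -/
theorem forall_lt_H_zeroFreq_iff (hB : ∀ i j, M.B i j = M.B j i)
    (hBoff : ∀ i j, i ≠ j → 0 ≤ M.B i j) (hBrow : ∀ i, ∑ j, M.B i j ≤ 0)
    (hkQ : ∀ i, 0 < M.kQ i) (hQu : ∀ i, 0 < M.Qu i) (θ : Fin n → ℝ) (c : ℝ) :
    (∀ V : Fin n → ℝ, (∀ i, 0 < V i) → c < M.H ((θ, 0, V) : State n)) ↔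
      c < M.H ((θ, 0, M.voltageProfile hB hBoff hBrow hkQ hQu θ) : State n) :=
  ⟨fun h => h _ (M.voltageProfile_spec hB hBoff hBrow hkQ hQu θ).1,
    fun h _ hV => lt_of_lt_of_le h (M.H_voltageProfile_le hB hBoff hBrow hkQ hQu θ hV)⟩

/-! ## §5 The voltage profile depends continuously on the angles -/

/-- `(θ, V) ↦ ∂H/∂V_i(θ, 0, V)` is continuous at every point with `V_i ≠ 0`. [cite: ShinZavala2020, eq. (11c)] -/
theorem continuousAt_dHV_zeroFreq {θ V : Fin n → ℝ} (i : Fin n) (hV : V i ≠ 0) :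
    ContinuousAt (fun p : (Fin n → ℝ) × (Fin n → ℝ) => M.dHV ((p.1, 0, p.2) : State n) i) (θ, V) := by
  have h1 : ContinuousAt (fun x : State n => M.dHV x i) ((θ, 0, V) : State n) :=
    (M.hasFDerivAt_dHV ((θ, 0, V) : State n) (by simpa using hV)).continuousAt
  have h2 : Continuous fun p : (Fin n → ℝ) × (Fin n → ℝ) => ((p.1, 0, p.2) : State n) :=
    continuous_fst.prodMk (continuous_const.prodMk continuous_snd)
  exact ContinuousAt.comp (g := fun x : State n => M.dHV x i)
    (f := fun p : (Fin n → ℝ) × (Fin n → ℝ) => ((p.1, 0, p.2) : State n)) (x := (θ, V))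
    h1 h2.continuousAt

/-- **The voltage profile `θ ↦ V°(θ)` is continuous** (dominantly inductive symmetric `B`, `k_Q > 0`,
`Q^u > 0`): near `θ₀` the profiles lie in one compact box (coercivity with a uniform level), every
cluster value is a positive critical point at `θ₀` (continuity of `∂H/∂V`), hence equals `V°(θ₀)`
(uniqueness) — so `V°(θ) → V°(θ₀)`. [cite: ShinZavala2020, eqs. (11c), (15b) and Appendix B (strict convexity ⇒ unique minimiser); SchifferEtAl2014, Remark 4.3] -/
theorem continuous_voltageProfile (hB : ∀ i j, M.B i j = M.B j i)
    (hBoff : ∀ i j, i ≠ j → 0 ≤ M.B i j) (hBrow : ∀ i, ∑ j, M.B i j ≤ 0)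
    (hkQ : ∀ i, 0 < M.kQ i) (hQu : ∀ i, 0 < M.Qu i) :
    Continuous fun θ => M.voltageProfile hB hBoff hBrow hkQ hQu θ := by
  set Vp : (Fin n → ℝ) → Fin n → ℝ := fun θ => M.voltageProfile hB hBoff hBrow hkQ hQu θ with hVp
  have hspec : ∀ θ, (∀ i, 0 < Vp θ i) ∧ ∀ i, M.dHV (θ, 0, Vp θ) i = 0 := fun θ =>
    M.voltageProfile_spec hB hBoff hBrow hkQ hQu θ
  refine continuous_iff_continuousAt.2 fun θ₀ => ?_
  -- a uniform level near `θ₀`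
  set V₁ : Fin n → ℝ := fun _ => 1 with hV₁
  set L : ℝ := M.H ((θ₀, 0, V₁) : State n) + 1 with hL
  have hHc : ContinuousAt (fun θ : Fin n → ℝ => M.H ((θ, 0, V₁) : State n)) θ₀ := by
    have h1 : ContinuousAt M.H ((θ₀, 0, V₁) : State n) :=
      M.continuousAt_H _ fun i => by simp [hV₁]
    have h2 : Continuous fun θ : Fin n → ℝ => ((θ, 0, V₁) : State n) :=
      continuous_id.prodMk (continuous_const.prodMk continuous_const)
    exact ContinuousAt.comp (g := M.H) (f := fun θ : Fin n → ℝ => ((θ, 0, V₁) : State n))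
      (x := θ₀) h1 h2.continuousAt
  have hPc : ContinuousAt (fun θ : Fin n → ℝ => ∑ j, M.Pu j * θ j) θ₀ :=
    (continuous_finsetSum _ fun j _ => continuous_const.mul (continuous_apply j)).continuousAt
  -- eventually: `H(θ, 0, 𝟙) ≤ L` and `|Σ P^u θ − Σ P^u θ₀| ≤ 1`
  have hev1 : ∀ᶠ θ in 𝓝 θ₀, M.H ((θ, 0, V₁) : State n) ≤ L := by
    have : Iio L ∈ 𝓝 (M.H ((θ₀, 0, V₁) : State n)) := Iio_mem_nhds (by rw [hL]; linarith)
    refine Filter.mem_of_superset (hHc.preimage_mem_nhds this) fun θ hθ => ?_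
    have h : M.H ((θ, 0, V₁) : State n) < L := Set.mem_Iio.1 (Set.mem_preimage.1 hθ)
    exact h.le
  have hev2 : ∀ᶠ θ in 𝓝 θ₀, |∑ j, M.Pu j * θ j - ∑ j, M.Pu j * θ₀ j| < 1 := by
    have : ball (∑ j, M.Pu j * θ₀ j) 1 ∈ 𝓝 (∑ j, M.Pu j * θ₀ j) := ball_mem_nhds _ one_pos
    exact Filter.mem_of_superset (hPc.preimage_mem_nhds this) fun θ hθ => by
      have h := mem_ball.1 (Set.mem_preimage.1 hθ)
      rwa [Real.dist_eq] at h
  -- the uniform box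
  set a : Fin n → ℝ := fun i => Real.exp (-(M.coordLevel θ₀ L i + 1) / M.Qu i) with ha
  set b : Fin n → ℝ := fun i =>
    2 * M.kQ i * (M.coordLevel θ₀ L i + 1 - M.Qu i + M.Qu i * Real.log (2 * M.Qu i * M.kQ i))
    with hb
  have hapos : ∀ i, 0 < a i := fun i => Real.exp_pos _
  have hK : IsCompact (Icc a b) := isCompact_Icc
  have hmem : ∀ᶠ θ in 𝓝 θ₀, Vp θ ∈ Icc a b := by
    filter_upwards [hev1, hev2] with θ h1 h2
    have hVθ := (hspec θ).1
    have hHle : M.H ((θ, 0, Vp θ) : State n) ≤ L :=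
      (M.H_voltageProfile_le hB hBoff hBrow hkQ hQu θ (V := V₁) fun i => by simp [hV₁]).trans h1
    have hlev : ∀ i, M.coordLevel θ L i ≤ M.coordLevel θ₀ L i + 1 := fun i => by
      simp only [coordLevel]
      linarith [(abs_lt.1 h2).2]
    refine ⟨fun i => ?_, fun i => ?_⟩
    · have hbox := (M.mem_box_of_H_le hB hBoff hBrow hkQ hQu θ hVθ hHle i).1
      refine le_trans ?_ hbox
      simp only [ha]
      refine Real.exp_le_exp.2 ?_
      rw [div_le_div_iff_of_pos_right (hQu i)]
      linarith [hlev i]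
    · have hbox := (M.mem_box_of_H_le hB hBoff hBrow hkQ hQu θ hVθ hHle i).2
      refine hbox.trans ?_
      simp only [hb]
      have hk2 : 0 ≤ 2 * M.kQ i := by linarith [hkQ i]
      exact mul_le_mul_of_nonneg_left (by linarith [hlev i]) hk2
  -- every cluster value is `V°(θ₀)`
  have hlim : Tendsto Vp (𝓝 θ₀) (𝓝 (Vp θ₀)) := by
    refine hK.tendsto_nhds_of_unique_mapClusterPt hmem fun y hy hcl => ?_
    have hypos : ∀ i, 0 < y i := fun i => lt_of_lt_of_le (hapos i) (hy.1 i)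
    have hcrit : ∀ i, M.dHV (θ₀, 0, y) i = 0 := by
      intro i
      by_contra hne
      have hg : ContinuousAt (fun p : (Fin n → ℝ) × (Fin n → ℝ) => M.dHV ((p.1, 0, p.2) : State n) i)
          (θ₀, y) := M.continuousAt_dHV_zeroFreq i (hypos i).ne'
      have hN : {p : (Fin n → ℝ) × (Fin n → ℝ) | M.dHV ((p.1, 0, p.2) : State n) i ≠ 0}
          ∈ 𝓝 (θ₀, y) := hg.preimage_mem_nhds (isOpen_ne.mem_nhds hne)
      obtain ⟨U, hU, W, hW, hUW⟩ := mem_nhds_prod_iff.1 hN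
      have hfreq : ∃ᶠ θ in 𝓝 θ₀, Vp θ ∈ W := (mapClusterPt_iff_frequently.1 hcl) W hW
      obtain ⟨θ, hθW, hθU⟩ := (hfreq.and_eventually hU).exists
      have hmemN := hUW (mk_mem_prod hθU hθW)
      exact hmemN ((hspec θ).2 i)
    exact M.voltageSolution_unique hB hBoff hBrow hQu θ₀ hypos (hspec θ₀).1 hcrit (hspec θ₀).2
  exact hlim

end DroopPH

end Literature.MathematicalPhysics.PowerSystems
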